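import Mathlib.NumberTheory.LSeries.MellinEqDirichlet
import Mathlib.NumberTheory.LSeries.Basic
import Mathlib.MeasureTheory.Integral.PeakFunction
import Mathlib.Analysis.SpecialFunctions.Integrals.Basic
import Mathlib.Analysis.SpecialFunctions.Pow.Asymptotics
import Mathlib.Analysis.SpecialFunctions.Gamma.Deriv
import HarnessLib

set_option autoImplicit false

/-!
# Crux `PrintCFram.BottomClassIndexLawFiveLe` (stmt-BirchSwinnertonDyer-20372), line `eisenstein-resource-bdp-line` (registry v24):
# (E4) OF THE CUSP-CONJUNCT ASSEMBLY, PART 1 — «ABEL LIMIT AT `0⁺` ⟹ RESIDUE OF THE MELLIN TRANSFORM» IN THE KERNEL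
# (cell `bsd-print-cfram`, width seat `bsd-line-cfram-p1-w5` g6; THEOREMS ONLY, `--supports` 20372; Mathlib currency;
# BSD is not proved by any of this)

HONEST FRAMING. General real/complex-analytic plumbing (no elliptic curve, no BSD): ingredient (E4) of the proof plan for the
cusp conjunct «`G = 0 ⟹ ι C = 0`» of the registered stub `stub_cuspCutForm` (= `hcut` of `CuspSeed.cuspSeed_six_of_cutForm`,
p688228; plan in crux notes `Lines/eisenstein-resource-bdp-line-w5g5-cusp-seed.md` §§2–5, §15). Lemma A there
(`CuspSeed.tendsto_zpow_mul_apply_ofComplex_I_mul`, p691154) identifies the constant term of a modular form `F` at the cusp `0`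
with the Abel limit `lim_{t→0⁺} t^w Σ_n a(n) e^{−2πnt}` of its Fourier coefficients at `∞`; Lemmas B–D there compute instead the
residue `lim_{s→w⁺} (s − w) L(F, s)` of the Dirichlet series `L(F,s) = Σ a(n) n^{−s}` (Rankin-type unfolding over the family of
quadratic twists). THIS FILE is the bridge between the two:

* `tendsto_sub_mul_mellin` — for `F : ℝ → ℂ` with `t ↦ t^w F(t)` integrable on `(0,∞)` and `t^w F(t) → ℓ` (`t → 0⁺`):
  `(s − w) · 𝓜F(s) → ℓ` as `s → w⁺`, `𝓜F = mellin F` (Mathlib). Proof: on `(0,1)` the kernel `(s−w) t^{s−w−1}` is an approximate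
  identity at `0⁺` (Mathlib's peak-function lemma `tendsto_setIntegral_peak_smul_of_integrableOn_of_tendsto`), on `(1,∞)` the
  integral stays bounded;
* `integrable_tsum_of_summable_integral_norm` — the `Integrable` companion of Mathlib's `integral_tsum_of_summable_integral_norm`
  (used by the companion file for `t^w Σ a(n)e^{−2πnt}`);
* the Dirichlet-series form «`t^w Σ_n a(n)e^{−2πnt} → ℓ` ⟹ `(s − w) L(a,s) → (2π)^w/Γ(w)·ℓ`» is the companion file
  `…CuspSeedAbelResidue.lean` (`CuspSeed.tendsto_sub_mul_LSeries_of_tendsto_rpow_smul_tsum`, via Mathlib `hasSum_mellin`).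

No Tauberian theorem is involved (this is the «Abelian» direction: EXISTENCE of the Abel limit is an input, supplied in the
application by modularity via Lemma A). Standard; e.g. the first step of Hecke's proof of the functional equation / Rankin's
method. [folklore]

References: [DiamondShurman2005] §5.9–5.10 (Mellin transform of a modular form); Mathlib `Mathlib.NumberTheory.LSeries.MellinEqDirichlet`,
`Mathlib.MeasureTheory.Integral.PeakFunction`.
-/

-- summit-side namespace `Summit.BirchSwinnertonDyer.BirchSwinnertonDyer.…` (single-conjunct summit, D-0017 layout)
set_option linter.dupNamespace false

namespace Summit.BirchSwinnertonDyer.BirchSwinnertonDyer.Theorems.PrintCFram.CuspSeed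

open Filter Set MeasureTheory Real
open scoped Topology

/-! ## §1 A dominated `tsum` of integrable functions is integrable -/

/-- If countably many integrable functions `F i` have summable `L¹` norms, then `a ↦ ∑' i, F i a` is integrable
(the `Integrable` companion of Mathlib's `integral_tsum_of_summable_integral_norm`). [folklore] -/
theorem integrable_tsum_of_summable_integral_norm {α ι E : Type*} [MeasurableSpace α] {μ : Measure α}
    [Countable ι] [NormedAddCommGroup E] [NormedSpace ℝ E] [CompleteSpace E] {F : ι → α → E}
    (hF_int : ∀ i, Integrable (F i) μ) (hF_sum : Summable fun i ↦ ∫ a, ‖F i a‖ ∂μ) :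
    Integrable (fun a ↦ ∑' i, F i a) μ := by
  have hmeas : ∀ i, AEMeasurable (fun a ↦ ‖F i a‖ₑ) μ := fun i ↦ (hF_int i).1.enorm
  have hlin : ∀ i, ∫⁻ a, ‖F i a‖ₑ ∂μ = ENNReal.ofReal (∫ a, ‖F i a‖ ∂μ) := by
    intro i
    rw [ofReal_integral_eq_lintegral_ofReal (hF_int i).norm (Eventually.of_forall fun _ ↦ norm_nonneg _)]
    refine lintegral_congr fun a ↦ ?_
    rw [ofReal_norm]
  have htop : ∑' i, ∫⁻ a, ‖F i a‖ₑ ∂μ ≠ ⊤ := by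
    simp_rw [hlin]
    rw [← ENNReal.ofReal_tsum_of_nonneg (fun i ↦ integral_nonneg fun _ ↦ norm_nonneg _) hF_sum]
    exact ENNReal.ofReal_ne_top
  -- a.e. summability of the norms
  have hae : ∀ᵐ a ∂μ, Summable fun i ↦ ‖F i a‖ := by
    have h1 : ∫⁻ a, ∑' i, ‖F i a‖ₑ ∂μ ≠ ⊤ := by rwa [lintegral_tsum hmeas]
    have h2 := ae_lt_top' (AEMeasurable.tsum hmeas) h1
    filter_upwards [h2] with a ha
    have : ∑' i, (‖F i a‖₊ : ENNReal) ≠ ⊤ := by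
      simpa only [enorm_eq_nnnorm] using ha.ne
    rw [ENNReal.tsum_coe_ne_top_iff_summable_coe] at this
    simpa only [coe_nnnorm] using this
  refine ⟨?_, ?_⟩
  · -- measurability: a.e. limit of the finite partial sums
    refine aestronglyMeasurable_of_tendsto_ae (u := (atTop : Filter (Finset ι)))
      (f := fun s a ↦ ∑ i ∈ s, F i a) (fun s ↦ ?_) ?_
    · exact Finset.aestronglyMeasurable_fun_sum s fun i _ ↦ (hF_int i).1
    · filter_upwards [hae] with a ha
      exact ha.of_norm.hasSum
  · rw [hasFiniteIntegral_iff_enorm]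
    calc ∫⁻ a, ‖∑' i, F i a‖ₑ ∂μ ≤ ∫⁻ a, ∑' i, ‖F i a‖ₑ ∂μ := lintegral_mono fun a ↦ enorm_tsum_le_tsum_enorm
      _ = ∑' i, ∫⁻ a, ‖F i a‖ₑ ∂μ := lintegral_tsum hmeas
      _ < ⊤ := htop.lt_top


/-! ## §2 The peak family `ε · t ^ (ε - 1)` on `(0, 1)` -/

/-- `∫_{(0,1)} ε · t^{ε−1} dt = 1` for `ε > 0`. [folklore] -/
theorem integral_Ioo_mul_rpow_sub_one {ε : ℝ} (hε : 0 < ε) :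
    ∫ t in Ioo (0 : ℝ) 1, ε * t ^ (ε - 1) = 1 := by
  rw [← integral_Ioc_eq_integral_Ioo, ← intervalIntegral.integral_of_le zero_le_one,
    intervalIntegral.integral_const_mul, integral_rpow (Or.inl (by linarith)), sub_add_cancel,
    Real.one_rpow, Real.zero_rpow hε.ne', sub_zero]
  field_simp

/-- The peak family `ε · t^{ε−1}` tends to `0` uniformly on `(0,1)` away from any neighbourhood of `0`, as `ε → 0⁺`
(on `[δ, 1)` it is bounded by `ε/δ`). [folklore] -/
theorem tendstoUniformlyOn_mul_rpow_sub_one {u : Set ℝ} (hu : IsOpen u) (h0 : (0 : ℝ) ∈ u) :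
    TendstoUniformlyOn (fun (ε t : ℝ) ↦ ε * t ^ (ε - 1)) 0 (𝓝[>] (0 : ℝ)) (Ioo 0 1 \ u) := by
  obtain ⟨δ, hδ, hball⟩ := Metric.isOpen_iff.1 hu 0 h0
  rw [Metric.tendstoUniformlyOn_iff]
  intro e he
  have hδe : 0 < min 1 (e * δ) := lt_min one_pos (mul_pos he hδ)
  filter_upwards [Ioo_mem_nhdsGT hδe] with ε hε t ht
  obtain ⟨hε0, hε1⟩ := hε
  have hεe : ε < e * δ := lt_of_lt_of_le hε1 (min_le_right _ _)
  obtain ⟨⟨ht0, ht1⟩, htu⟩ := ht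
  have hε1' : ε ≤ 1 := (lt_of_lt_of_le hε1 (min_le_left _ _)).le
  have hδt : δ ≤ t := by
    by_contra h
    rw [not_le] at h
    refine htu (hball ?_)
    rw [Metric.mem_ball, Real.dist_eq, sub_zero, abs_of_pos ht0]
    exact h
  have hδ1 : δ ≤ 1 := hδt.trans ht1.le
  simp only [Pi.zero_apply, Real.dist_eq, zero_sub, abs_neg]
  rw [abs_of_nonneg (mul_nonneg hε0.le (Real.rpow_nonneg ht0.le _))]
  calc ε * t ^ (ε - 1) ≤ ε * δ ^ (ε - 1) :=
        mul_le_mul_of_nonneg_left (Real.rpow_le_rpow_of_nonpos hδ hδt (by linarith)) hε0.le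
    _ = ε * (δ ^ ε / δ) := by rw [Real.rpow_sub_one hδ.ne']
    _ ≤ ε * (1 / δ) := by
        gcongr
        exact Real.rpow_le_one hδ.le hδ1 hε0.le
    _ < e := by rw [mul_one_div, div_lt_iff₀ hδ]; exact hεe

/-- The peak family is nonnegative on `(0,1)` (eventually in `ε → 0⁺`). [folklore] -/
theorem eventually_mul_rpow_sub_one_nonneg :
    ∀ᶠ ε : ℝ in 𝓝[>] (0 : ℝ), ∀ t ∈ Ioo (0 : ℝ) 1, 0 ≤ ε * t ^ (ε - 1) := by
  filter_upwards [self_mem_nhdsWithin] with ε (hε : 0 < ε) t ht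
  exact mul_nonneg hε.le (Real.rpow_nonneg ht.1.le _)

/-- The peak family has total mass tending to (indeed equal to) `1`. [folklore] -/
theorem tendsto_integral_Ioo_mul_rpow_sub_one :
    Tendsto (fun ε : ℝ ↦ ∫ t in Ioo (0 : ℝ) 1, ε * t ^ (ε - 1)) (𝓝[>] (0 : ℝ)) (𝓝 1) := by
  refine tendsto_const_nhds.congr' ?_
  filter_upwards [self_mem_nhdsWithin] with ε (hε : 0 < ε)
  exact (integral_Ioo_mul_rpow_sub_one hε).symm

/-- The peak family is (eventually) a.e.-strongly measurable on `(0,1)`. [folklore] -/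
theorem eventually_aestronglyMeasurable_mul_rpow_sub_one :
    ∀ᶠ ε : ℝ in 𝓝[>] (0 : ℝ), AEStronglyMeasurable (fun t : ℝ ↦ ε * t ^ (ε - 1)) (volume.restrict (Ioo 0 1)) := by
  filter_upwards [self_mem_nhdsWithin] with ε (_hε : 0 < ε)
  refine ContinuousOn.aestronglyMeasurable ?_ measurableSet_Ioo
  exact continuousOn_const.mul (continuousOn_id.rpow_const fun t ht ↦ Or.inl ht.1.ne')

/-- **Approximate identity at `0⁺`.** If `g` is integrable on `(0,1)` and `g(t) → ℓ` as `t → 0⁺`, then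
`∫₀¹ ε t^{ε−1} g(t) dt → ℓ` as `ε → 0⁺` (Mathlib's peak-function lemma for the family `ε t^{ε−1}`). [folklore] -/
theorem tendsto_integral_mul_rpow_sub_one_smul {g : ℝ → ℂ} {ℓ : ℂ}
    (hg : IntegrableOn g (Ioo 0 1)) (hlim : Tendsto g (𝓝[>] 0) (𝓝 ℓ)) :
    Tendsto (fun ε : ℝ ↦ ∫ t in Ioo (0 : ℝ) 1, (ε * t ^ (ε - 1)) • g t) (𝓝[>] (0 : ℝ)) (𝓝 ℓ) := by
  have hcg : Tendsto g (𝓝[Ioo 0 1] 0) (𝓝 ℓ) := hlim.mono_left (nhdsWithin_mono _ Ioo_subset_Ioi_self)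
  have hvol : volume (Ioo (0 : ℝ) 1) ≠ ⊤ := by simp [Real.volume_Ioo]
  exact tendsto_setIntegral_peak_smul_of_integrableOn_of_tendsto (μ := volume) measurableSet_Ioo
    measurableSet_Ioo Subset.rfl self_mem_nhdsWithin hvol eventually_mul_rpow_sub_one_nonneg
    (fun u hu hu0 ↦ tendstoUniformlyOn_mul_rpow_sub_one hu hu0) tendsto_integral_Ioo_mul_rpow_sub_one
    eventually_aestronglyMeasurable_mul_rpow_sub_one hg hcg

/-- Under the same hypotheses, `t ↦ t^{ε−1} g(t)` is integrable on `(0,1)` for all small `ε > 0`. [folklore] -/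
theorem eventually_integrableOn_rpow_sub_one_smul {g : ℝ → ℂ} {ℓ : ℂ}
    (hg : IntegrableOn g (Ioo 0 1)) (hlim : Tendsto g (𝓝[>] 0) (𝓝 ℓ)) :
    ∀ᶠ ε : ℝ in 𝓝[>] (0 : ℝ), IntegrableOn (fun t : ℝ ↦ (t ^ (ε - 1)) • g t) (Ioo 0 1) := by
  have hcg : Tendsto g (𝓝[Ioo 0 1] 0) (𝓝 ℓ) := hlim.mono_left (nhdsWithin_mono _ Ioo_subset_Ioi_self)
  have h := integrableOn_peak_smul_of_integrableOn_of_tendsto (μ := volume)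
    (measurableSet_Ioo : MeasurableSet (Ioo (0 : ℝ) 1)) self_mem_nhdsWithin
    (fun u hu hu0 ↦ tendstoUniformlyOn_mul_rpow_sub_one hu hu0) tendsto_integral_Ioo_mul_rpow_sub_one
    eventually_aestronglyMeasurable_mul_rpow_sub_one hg hcg
  filter_upwards [h, self_mem_nhdsWithin] with ε hε (hε0 : 0 < ε)
  have heq : (fun t : ℝ ↦ (t ^ (ε - 1)) • g t) = fun t ↦ ε⁻¹ • ((ε * t ^ (ε - 1)) • g t) := by
    funext t
    rw [smul_smul, ← mul_assoc, inv_mul_cancel₀ hε0.ne', one_mul]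
  rw [heq]
  exact hε.smul ε⁻¹

/-! ## §3 Abelian residue lemma for the Mellin transform -/

/-- **Abel limit at `0⁺` ⟹ residue of the Mellin transform.** Let `F : ℝ → ℂ` with `t ↦ t^w F(t)` integrable on
`(0, ∞)` and `t^w F(t) → ℓ` as `t → 0⁺`. Then `(s − w) · 𝓜F(s) → ℓ` as `s → w⁺` (real `s`), where
`𝓜F(s) = ∫₀^∞ t^{s−1} F(t) dt` is Mathlib's `mellin`. Proof: on `(0,1)`, `(s−w) t^{s−1}F = (ε t^{ε−1}) · (t^w F)` with
`ε = s − w` is an approximate identity against a function with limit `ℓ` at `0⁺`; on `(1,∞)` the integral stays bounded.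
[folklore] -/
theorem tendsto_sub_mul_mellin {F : ℝ → ℂ} {w : ℝ} {ℓ : ℂ}
    (hint : IntegrableOn (fun t : ℝ ↦ (t ^ w) • F t) (Ioi 0))
    (hlim : Tendsto (fun t : ℝ ↦ (t ^ w) • F t) (𝓝[>] 0) (𝓝 ℓ)) :
    Tendsto (fun s : ℝ ↦ ((s - w : ℝ) : ℂ) * mellin F s) (𝓝[>] w) (𝓝 ℓ) := by
  set g : ℝ → ℂ := fun t ↦ (t ^ w) • F t with hg
  -- the Mellin integrand in terms of `g`
  have hmel : ∀ s : ℝ, mellin F s = ∫ t in Ioi (0 : ℝ), (t ^ (s - w - 1)) • g t := by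
    intro s
    refine setIntegral_congr_fun measurableSet_Ioi fun t (ht : 0 < t) ↦ ?_
    simp only [hg, smul_eq_mul, Complex.real_smul]
    rw [show ((s : ℂ) - 1) = ((s - 1 : ℝ) : ℂ) by push_cast; ring, ← Complex.ofReal_cpow ht.le, ← mul_assoc,
      ← Complex.ofReal_mul, ← Real.rpow_add ht]
    congr 3
    ring
  -- the change of variable `ε = s - w`
  have hε : Tendsto (fun s : ℝ ↦ s - w) (𝓝[>] w) (𝓝[>] 0) := by
    refine tendsto_nhdsWithin_iff.2 ⟨?_, ?_⟩
    · have h := ((continuous_sub_right w).tendsto w).mono_left (nhdsWithin_le_nhds (s := Ioi w))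
      simpa using h
    · filter_upwards [self_mem_nhdsWithin] with s (hs : w < s)
      exact sub_pos.2 hs
  have hg01 : IntegrableOn g (Ioo 0 1) := hint.mono_set Ioo_subset_Ioi_self
  have hgI : IntegrableOn g (Ioi 1) := hint.mono_set (Ioi_subset_Ioi zero_le_one)
  -- piece on `(0,1)`
  have h1 : Tendsto (fun s : ℝ ↦ ∫ t in Ioo (0 : ℝ) 1, ((s - w) * t ^ (s - w - 1)) • g t) (𝓝[>] w) (𝓝 ℓ) :=
    (tendsto_integral_mul_rpow_sub_one_smul hg01 hlim).comp hε
  -- piece on `(1,∞)`: the integrand is dominated by `‖g‖` when `s ≤ w + 1`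
  have hdom : ∀ s : ℝ, s ≤ w + 1 → ∀ᵐ t ∂(volume.restrict (Ioi (1 : ℝ))),
      ‖(t ^ (s - w - 1)) • g t‖ ≤ ‖g t‖ := by
    intro s hs
    filter_upwards [ae_restrict_mem measurableSet_Ioi] with t (ht : 1 < t)
    rw [norm_smul, Real.norm_of_nonneg (Real.rpow_nonneg (zero_le_one.trans ht.le) _)]
    exact mul_le_of_le_one_left (norm_nonneg _) (Real.rpow_le_one_of_one_le_of_nonpos ht.le (by linarith))
  have h2int : ∀ s : ℝ, s ≤ w + 1 → IntegrableOn (fun t : ℝ ↦ (t ^ (s - w - 1)) • g t) (Ioi 1) := by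
    intro s hs
    refine Integrable.mono' hgI.norm ?_ (hdom s hs)
    exact ((continuousOn_id.rpow_const fun t ht ↦ Or.inl (zero_lt_one.trans ht).ne').aestronglyMeasurable
      measurableSet_Ioi).smul hgI.aestronglyMeasurable
  have h2 : Tendsto (fun s : ℝ ↦ ((s - w : ℝ) : ℂ) * ∫ t in Ioi (1 : ℝ), (t ^ (s - w - 1)) • g t)
      (𝓝[>] w) (𝓝 0) := by
    have hK : Tendsto (fun s : ℝ ↦ (s - w) * ∫ t in Ioi (1 : ℝ), ‖g t‖) (𝓝[>] w) (𝓝 0) := by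
      have h := (((continuous_sub_right w).tendsto w).mul_const (∫ t in Ioi (1 : ℝ), ‖g t‖)).mono_left
        (nhdsWithin_le_nhds (s := Ioi w))
      simpa using h
    refine squeeze_zero_norm' ?_ hK
    filter_upwards [Ioo_mem_nhdsGT (show w < w + 1 by linarith)] with s hs
    rw [norm_mul, Complex.norm_real, Real.norm_of_nonneg (sub_pos.2 hs.1).le]
    exact mul_le_mul_of_nonneg_left (norm_integral_le_of_norm_le hgI.norm (hdom s hs.2.le)) (sub_pos.2 hs.1).le
  -- eventually the Mellin integral splits as the sum of the two pieces
  have hsplit : (fun s : ℝ ↦ ((s - w : ℝ) : ℂ) * mellin F s) =ᶠ[𝓝[>] w] fun s ↦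
      (∫ t in Ioo (0 : ℝ) 1, ((s - w) * t ^ (s - w - 1)) • g t) +
        ((s - w : ℝ) : ℂ) * ∫ t in Ioi (1 : ℝ), (t ^ (s - w - 1)) • g t := by
    filter_upwards [hε.eventually (eventually_integrableOn_rpow_sub_one_smul hg01 hlim),
      Ioo_mem_nhdsGT (show w < w + 1 by linarith)] with s hs1 hs
    rw [hmel s, ← Ioc_union_Ioi_eq_Ioi zero_le_one, setIntegral_union Ioc_disjoint_Ioi_same measurableSet_Ioi
      ((integrableOn_Ioc_iff_integrableOn_Ioo (hb := by finiteness)).2 hs1) (h2int s hs.2.le), integral_Ioc_eq_integral_Ioo, mul_add]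
    congr 1
    rw [← smul_eq_mul, Complex.coe_smul, ← integral_smul]
    refine integral_congr_ae (Eventually.of_forall fun t ↦ ?_)
    simp only [smul_smul]
  rw [tendsto_congr' hsplit]
  simpa using h1.add h2


end Summit.BirchSwinnertonDyer.BirchSwinnertonDyer.Theorems.PrintCFram.CuspSeed
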